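import Summits.CriticalPhenomena.Ising3DConformalLimit.Theorems.ArmHyperscalingOneArmHyperscalingMirrorFaceDefs
import Literature.Probability.LatticeModels.PlusStateFKG
import Literature.Probability.LatticeModels.IsingFieldVolume
import HarnessLib

/-!
# The face-frozen magnetisation converges to the face-conditioned magnetisation
(route ArmHyperscaling, crux `OneArmHyperscaling`, item stmt-CriticalPhenomena-15591, line
`mirror-face-saturation`, registered stub `stub_faceLimit : FaceLimit`)

Statement (`stub_faceLimit`, literally the line's `def FaceLimit : Prop` of the definitions module
`Theorems/ArmHyperscalingOneArmHyperscalingMirrorFaceDefs.lean`): on `ℤ³` at `β_c(3)`, `h = 0`, with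
`x = evalSite n`, `E = facePatch K n` and any translation `v`,
`⟨σ_x⟩⁺_{(Λ_L + v) ∖ E} → faceMag K n = ⟨σ_x 𝟙_{E⁺}⟩_{β_c} / ⟨𝟙_{E⁺}⟩_{β_c}` as `L → ∞`, where
`𝟙_{E⁺} = plusIndicator E = ∏_{y ∈ E} (1 + σ_y)/2` and `⟨·⟩_{β_c} = plusExpect 3 (criticalBeta 3) 0`.

Proof.
1. Spatial Markov property (Friedli–Velenik 2017, §3.6.3 eq. (3.26); tree
   `fieldExpect_fixed_eq_cond` with `η ≡ +1`, where `agreeIndicator E 1 = plusIndicator E`): for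
   `E ⊆ Λ`, `⟨F⟩⁺_{Λ ∖ E} = ⟨F 𝟙_{E⁺}⟩⁺_Λ / ⟨𝟙_{E⁺}⟩⁺_Λ` (`isingExpect_plus_sdiff_eq_cond`); and
   `E ⊆ Λ_L + v` for all large `L`.
2. `x ∉ E`, so `σ_x 𝟙_{E⁺} = 2 𝟙_{(E ∪ {x})⁺} − 𝟙_{E⁺}` pointwise (`spinAt_mul_plusIndicator`), and
   finite-volume expectations are linear.
3. Along translated boxes `⟨𝟙_{B⁺}⟩⁺_{Λ_L + v} → ⟨𝟙_{B⁺}⟩⁺` (Friedli–Velenik 2017, Thm. 3.17 from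
   FKG: tree `tendsto_isingExpect_plus_plusIndicator_comp_shift`, `isingExpect_plus_shift`,
   `ising_fkg_holds`), for `B = E` and `B = insert x E`; along centred boxes this identifies
   `⟨𝟙_{E⁺}⟩_{β_c}` and `⟨σ_x 𝟙_{E⁺}⟩_{β_c} = 2⟨𝟙_{(E∪{x})⁺}⟩ − ⟨𝟙_{E⁺}⟩` (the `limUnder` of a
   convergent sequence is its limit).
4. The denominator limit is positive: `𝟙_{E⁺} = 2^{-|E|} Σ_{A ⊆ E} σ_A` and GKS I
   (`GKSInequalities.gks_one_holds`, Friedli–Velenik Thm. 3.20) give `⟨𝟙_{E⁺}⟩⁺_Λ ≥ 2^{-|E|}` once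
   `E ⊆ Λ`, hence `⟨𝟙_{E⁺}⟩_{β_c} ≥ 2^{-|E|} > 0`; conclude with `Tendsto.div`.

References: S. Friedli, Y. Velenik, *Statistical Mechanics of Lattice Systems* (CUP 2017), §3.6.2
(Lemma 3.19), §3.6.3 eq. (3.26), Thm. 3.17, Thm. 3.20.  No definitions are introduced; the
finite-volume helper lemmas are stated for an arbitrary locally finite graph.
-/

noncomputable section

namespace Summit.CriticalPhenomena.Ising3DConformalLimit.Cruxes.OneArmHyperscaling.MirrorFaceSaturation

open Literature.Probability.LatticeModels Finset Filter Topology MeasureTheory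

section General

variable {V : Type*} [DecidableEq V] (G : SimpleGraph V) [G.LocallyFinite]

omit [DecidableEq V] in
/-- Agreement with the all-plus configuration on `D` is the increasing indicator `𝟙_{D⁺}`:
`agreeIndicator D 1 = plusIndicator D` (Friedli–Velenik 2017, §3.6.2–§3.6.3). -/
private theorem agreeIndicator_one_eq_plusIndicator (D : Finset V) :
    agreeIndicator D (1 : SpinConfig V) = plusIndicator D := by
  funext σ
  rw [plusIndicator_eq]
  unfold agreeIndicator
  by_cases h : ∀ x ∈ D, σ x = 1
  · rw [if_pos (show ∀ x ∈ D, σ x = (1 : SpinConfig V) x from h), if_pos h]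
  · rw [if_neg (show ¬ ∀ x ∈ D, σ x = (1 : SpinConfig V) x from h), if_neg h]

/-- **Spatial Markov property, plus boundary condition** (Friedli–Velenik 2017, §3.6.3 eq. (3.26):
`μ⁺_Λ(· | σ ≡ +1 on E) = μ⁺_{Λ∖E}`): for `E ⊆ Λ` and measurable `F`,
`⟨F⟩⁺_{Λ∖E;β,h} = ⟨F 𝟙_{E⁺}⟩⁺_{Λ;β,h} / ⟨𝟙_{E⁺}⟩⁺_{Λ;β,h}` (tree `fieldExpect_fixed_eq_cond` with
`η ≡ +1`, `Λ' = Λ ∖ E`). -/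
private theorem isingExpect_plus_sdiff_eq_cond {E Λ : Finset V} (hE : E ⊆ Λ) (β h : ℝ)
    {F : SpinConfig V → ℝ} (hF : Measurable F) :
    isingExpect G (Λ \ E) β h .plus F =
      isingExpect G Λ β h .plus (fun σ => F σ * plusIndicator E σ) /
        isingExpect G Λ β h .plus (plusIndicator E) := by
  have hsub : Λ \ E ⊆ Λ := sdiff_subset
  have hcond := fieldExpect_fixed_eq_cond G hsub (1 : SpinConfig V) β (fun _ => h) hF
  have hbc : (BoundaryCondition.fixed 1 : BoundaryCondition V) = .plus := rfl
  rw [fieldExpect_const, fieldExpect_const, fieldExpect_const, hbc, Finset.sdiff_sdiff_eq_self hE,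
    agreeIndicator_one_eq_plusIndicator] at hcond
  exact hcond

/-- For `x ∉ E`: `σ_x 𝟙_{E⁺} = 2 𝟙_{(insert x E)⁺} − 𝟙_{E⁺}` (since `𝟙_{(insert x E)⁺} = (1+σ_x)/2 · 𝟙_{E⁺}`). -/
private theorem spinAt_mul_plusIndicator {x : V} {E : Finset V} (hx : x ∉ E) (σ : SpinConfig V) :
    spinAt x σ * plusIndicator E σ = 2 * plusIndicator (insert x E) σ - plusIndicator E σ := by
  simp only [plusIndicator, Finset.prod_insert hx]
  ring

/-- Linearity of finite-volume expectations in the shape used here: `⟨2f − g⟩ = 2⟨f⟩ − ⟨g⟩`. -/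
private theorem isingExpect_two_mul_sub (Λ : Finset V) (β h : ℝ)
    (bc : BoundaryCondition V) {f g : SpinConfig V → ℝ} (hf : Measurable f) (hg : Measurable g) :
    isingExpect G Λ β h bc (fun σ => 2 * f σ - g σ) =
      2 * isingExpect G Λ β h bc f - isingExpect G Λ β h bc g := by
  have h1 : (fun σ => 2 * f σ - g σ) = fun σ => 2 * f σ + (-1) * g σ := by
    funext σ; ring
  rw [h1, isingExpect_add' G Λ h bc β (hf.const_mul 2) (hg.const_mul (-1)),
    isingExpect_const_mul' G Λ h bc β 2 hf, isingExpect_const_mul' G Λ h bc β (-1) hg]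
  ring

/-- **Friedli–Velenik 2017, Lemma 3.19, inverse direction**: the increasing indicator is a binomial
average of spin products, `𝟙_{E⁺} = ∏_{y∈E} (1+σ_y)/2 = 2^{-|E|} Σ_{A ⊆ E} σ_A`. -/
private theorem plusIndicator_eq_sum_spinProduct (E : Finset V) (σ : SpinConfig V) :
    plusIndicator E σ = (1 / 2 : ℝ) ^ #E * ∑ A ∈ E.powerset, spinProduct A σ := by
  have h1 : plusIndicator E σ = (∏ y ∈ E, (spinAt y σ + 1)) * ∏ _y ∈ E, (1 / 2 : ℝ) := by
    rw [plusIndicator, ← Finset.prod_mul_distrib]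
    exact Finset.prod_congr rfl fun y _ => by ring
  rw [h1, Finset.prod_const, mul_comm, Finset.prod_add]
  congr 1
  refine Finset.sum_congr rfl fun A _ => ?_
  rw [Finset.prod_const_one, mul_one]
  rfl

/-- **Uniform lower bound for the conditioning event** (GKS I, Friedli–Velenik 2017, Thm. 3.20,
eq. (3.21)): for `β, h ≥ 0` and `E ⊆ Λ`, `⟨𝟙_{E⁺}⟩⁺_{Λ;β,h} = 2^{-|E|} Σ_{A⊆E} ⟨σ_A⟩⁺_Λ ≥ 2^{-|E|}`
(the term `A = ∅` is `1`, the others are `≥ 0`). -/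
private theorem half_pow_le_isingExpect_plusIndicator {β h : ℝ} (hβ : 0 ≤ β) (hh : 0 ≤ h)
    {E Λ : Finset V} (hE : E ⊆ Λ) :
    (1 / 2 : ℝ) ^ #E ≤ isingExpect G Λ β h .plus (plusIndicator E) := by
  have hexp : plusIndicator E = fun σ => (1 / 2 : ℝ) ^ #E * ∑ A ∈ E.powerset, spinProduct A σ :=
    funext (plusIndicator_eq_sum_spinProduct E)
  rw [hexp, isingExpect_const_mul' G Λ h _ β _
      (Finset.measurable_sum _ fun A _ => measurable_spinProduct A),
    isingExpect_finset_sum' G Λ h _ β E.powerset (fun A σ => spinProduct A σ)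
      fun A => measurable_spinProduct A]
  have h0 : isingExpect G Λ β h .plus (fun σ => spinProduct (∅ : Finset V) σ) = 1 := by
    simp only [spinProduct, Finset.prod_empty]
    exact isingExpect_const G Λ β h .plus 1
  have hrest : 0 ≤ ∑ A ∈ E.powerset.erase ∅, isingExpect G Λ β h .plus (fun σ => spinProduct A σ) :=
    Finset.sum_nonneg fun A hA => GKSInequalities.gks_one_holds G hβ hh (Or.inr rfl)
      ((Finset.mem_powerset.1 (Finset.mem_of_mem_erase hA)).trans hE)
  have hsum : 1 ≤ ∑ A ∈ E.powerset, isingExpect G Λ β h .plus (fun σ => spinProduct A σ) := by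
    rw [← Finset.add_sum_erase _ _ (Finset.empty_mem_powerset E), h0]
    linarith
  calc (1 / 2 : ℝ) ^ #E = (1 / 2 : ℝ) ^ #E * 1 := (mul_one _).symm
    _ ≤ (1 / 2 : ℝ) ^ #E * ∑ A ∈ E.powerset, isingExpect G Λ β h .plus (fun σ => spinProduct A σ) :=
      mul_le_mul_of_nonneg_left hsum (by positivity)

end General

/-! ### On `ℤ^d`: limits along translated boxes -/

section Zd

variable {d : ℕ}

/-- **Plus expectations of increasing indicators along translated boxes** (Friedli–Velenik 2017,
Thm. 3.17, from FKG): `⟨𝟙_{B⁺}⟩⁺_{Λ_L + v;β,h} → ⟨𝟙_{B⁺}⟩⁺_{β,h}` for `β ≥ 0`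
(`tendsto_isingExpect_plus_plusIndicator_comp_shift` + translation covariance `isingExpect_plus_shift`). -/
private theorem tendsto_isingExpect_plus_map_shift_plusIndicator {β : ℝ} (hβ : 0 ≤ β) (h : ℝ)
    (B : Finset (Site d)) (v : Site d) :
    Tendsto (fun L : ℕ => isingExpect (zdGraph d) ((box d L).map (Site.shift v).toEmbedding) β h
      .plus (plusIndicator B)) atTop (𝓝 (plusExpect d β h (plusIndicator B))) := by
  refine (tendsto_isingExpect_plus_plusIndicator_comp_shift
    (fun _ => ising_fkg_holds (zdGraph d)) hβ h B v).congr fun L => ?_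
  exact (isingExpect_plus_shift (box d L) v β h (measurable_plusIndicator B)).symm

/-- Every finite set lies in the translated boxes `Λ_L + v` eventually. -/
private theorem eventually_subset_map_shift_box (E : Finset (Site d)) (v : Site d) :
    ∀ᶠ L : ℕ in atTop, E ⊆ (box d L).map (Site.shift v).toEmbedding := by
  have : ∀ᶠ L : ℕ in atTop, ∀ y ∈ E, y ∈ (box d L).map (Site.shift v).toEmbedding := by
    refine (Filter.eventually_all_finset E).2 fun y _ => ?_
    filter_upwards [eventually_mem_box (y - v)] with L hL
    exact (mem_map_shift_iff' (box d L) v y).2 hL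
  exact this.mono fun L hL y hy => hL y hy

/-- **The plus state gives positive mass to `{σ ≡ +1 on E}`**: `⟨𝟙_{E⁺}⟩⁺_{β,h} ≥ 2^{-|E|}` for
`β, h ≥ 0` (GKS I in the boxes containing `E`, and the box limit of Friedli–Velenik Thm. 3.17). -/
private theorem half_pow_le_plusExpect_plusIndicator {β h : ℝ} (hβ : 0 ≤ β) (hh : 0 ≤ h)
    (E : Finset (Site d)) : (1 / 2 : ℝ) ^ #E ≤ plusExpect d β h (plusIndicator E) := by
  refine ge_of_tendsto (tendsto_isingExpect_plus_plusIndicator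
    (fun _ => ising_fkg_holds (zdGraph d)) hβ h E) ?_
  obtain ⟨L₀, hL₀⟩ := exists_forall_subset_box d E
  exact eventually_atTop.2 ⟨L₀, fun L hL =>
    half_pow_le_isingExpect_plusIndicator (zdGraph d) hβ hh (hL₀ L hL)⟩

end Zd

/-! ### The registered stub -/

/-- The evaluation site `x_n = n e₀` does not lie on the face `facePatch K n` (their first
coordinates `n` and `n − Kn − 1` differ). -/
private theorem evalSite_not_mem_facePatch (K n : ℕ) : evalSite n ∉ facePatch K n := by
  intro h
  rw [facePatch, Fintype.mem_piFinset] at h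
  have h0 := h 0
  simp only [if_true, Finset.mem_singleton, evalSite, Pi.single_eq_same] at h0
  have hKn : (0 : ℤ) ≤ ((K * n : ℕ) : ℤ) := Nat.cast_nonneg _
  generalize ((K * n : ℕ) : ℤ) = m at h0 hKn
  omega

/-- **(LIM) the face-frozen magnetisation converges to `faceMag`** (registered stub `stub_faceLimit`
of line `mirror-face-saturation`): for every `K n v`,
`⟨σ_{x_n}⟩⁺_{(Λ_L + v) ∖ facePatch K n; β_c, 0} → faceMag K n` as `L → ∞`.  Spatial Markov property
(Friedli–Velenik 2017, eq. (3.26)) in the translated boxes, `σ_x 𝟙_{E⁺} = 2𝟙_{(E∪{x})⁺} − 𝟙_{E⁺}`,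
convergence of plus expectations of increasing indicators along (translated) boxes (Thm. 3.17 from
FKG) and positivity of `⟨𝟙_{E⁺}⟩_{β_c} ≥ 2^{-|E|}` (GKS I). -/
theorem stub_faceLimit : FaceLimit := by
  intro K n v
  classical
  have hβ : 0 ≤ criticalBeta 3 := criticalBeta_nonneg 3
  have hfkg : ∀ β : ℝ, ising_fkg (zdGraph 3) (β := β) := fun _ => ising_fkg_holds (zdGraph 3)
  set E := facePatch K n with hEdef
  set x := evalSite n with hxdef
  have hxE : x ∉ E := evalSite_not_mem_facePatch K n
  set A := plusExpect 3 (criticalBeta 3) 0 (plusIndicator (insert x E)) with hAdef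
  set B := plusExpect 3 (criticalBeta 3) 0 (plusIndicator E) with hBdef
  -- limits along the translated boxes `Λ_L + v`
  have ha := tendsto_isingExpect_plus_map_shift_plusIndicator hβ 0 (insert x E) v
  have hb := tendsto_isingExpect_plus_map_shift_plusIndicator hβ 0 E v
  -- the denominator limit is positive
  have hBpos : 0 < B :=
    lt_of_lt_of_le (by positivity) (half_pow_le_plusExpect_plusIndicator hβ le_rfl E)
  -- the numerator of `faceMag`
  have hfun : (fun σ => spinAt x σ * plusIndicator E σ) =
      fun σ => 2 * plusIndicator (insert x E) σ - plusIndicator E σ :=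
    funext (spinAt_mul_plusIndicator hxE)
  have hlin : ∀ Λ : Finset (Site 3),
      isingExpect (zdGraph 3) Λ (criticalBeta 3) 0 .plus
          (fun σ => 2 * plusIndicator (insert x E) σ - plusIndicator E σ) =
        2 * isingExpect (zdGraph 3) Λ (criticalBeta 3) 0 .plus (plusIndicator (insert x E)) -
          isingExpect (zdGraph 3) Λ (criticalBeta 3) 0 .plus (plusIndicator E) := fun Λ =>
    isingExpect_two_mul_sub (zdGraph 3) Λ (criticalBeta 3) 0 .plus
      (measurable_plusIndicator _) (measurable_plusIndicator _)
  have hnum : critExpect (fun σ => spinAt x σ * plusIndicator E σ) = 2 * A - B := by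
    rw [hfun]
    change limUnder atTop (fun L : ℕ => isingExpect (zdGraph 3) (box 3 L) (criticalBeta 3) 0 .plus
      (fun σ => 2 * plusIndicator (insert x E) σ - plusIndicator E σ)) = 2 * A - B
    refine Tendsto.limUnder_eq ?_
    simp_rw [hlin]
    exact ((tendsto_isingExpect_plus_plusIndicator hfkg hβ 0 (insert x E)).const_mul 2).sub
      (tendsto_isingExpect_plus_plusIndicator hfkg hβ 0 E)
  have hface : faceMag K n = (2 * A - B) / B := by
    change critExpect (fun σ => spinAt x σ * plusIndicator E σ) / critExpect (plusIndicator E) = _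
    rw [hnum]
    rfl
  rw [hface]
  -- eventually the frozen magnetisation is the finite-volume conditional ratio
  have heq : (fun L : ℕ =>
      (2 * isingExpect (zdGraph 3) ((box 3 L).map (Site.shift v).toEmbedding) (criticalBeta 3) 0
          .plus (plusIndicator (insert x E)) -
        isingExpect (zdGraph 3) ((box 3 L).map (Site.shift v).toEmbedding) (criticalBeta 3) 0
          .plus (plusIndicator E)) /
      isingExpect (zdGraph 3) ((box 3 L).map (Site.shift v).toEmbedding) (criticalBeta 3) 0
          .plus (plusIndicator E)) =ᶠ[atTop] fun L : ℕ => frozenMagShift n L v E := by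
    filter_upwards [eventually_subset_map_shift_box E v] with L hL
    change _ = isingExpect (zdGraph 3) ((box 3 L).map (Site.shift v).toEmbedding \ E)
      (criticalBeta 3) 0 .plus (spinAt x)
    rw [isingExpect_plus_sdiff_eq_cond (zdGraph 3) hL (criticalBeta 3) 0 (measurable_spinAt x),
      hfun, hlin]
  refine Tendsto.congr' heq ?_
  exact ((ha.const_mul 2).sub hb).div hb hBpos.ne'

end Summit.CriticalPhenomena.Ising3DConformalLimit.Cruxes.OneArmHyperscaling.MirrorFaceSaturation

end
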